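import Mathlib
import Literature.Probability.LatticeModels.LatticeSineGordon
import HarnessLib

/-!
# The compact (neutral) lattice sine-Gordon gas on the discrete torus: zero mode reduced modulo a period lattice

Topic `Probability/LatticeModels`. Companion DEFINITION file to `LatticeSineGordon` (the `ε`-regulated
multi-component lattice sine-Gordon / vector Coulomb gas on `(ℤ/N)ᵈ`): the `ε = 0` model with COMPACT
zero mode, wanted by route `QuantumFields/YangMills/SmallCircleAnchor` (crux `AnchorGap`,
stmt-QuantumFields-11141, registered stub `stub_debyeScreening`: Debye screening on the three-torus with
the regulator removed before the volume limit — its fixed-volume `ε → 0` limit, and the seam object of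
`stub_abelianisation`: the monopole gas on a closed spatial torus is NEUTRAL by Gauss' law, so its
sine-Gordon field has a flat zero mode defined only modulo the lattice dual to the charges) and by
route `QuantumFields/QCD/CentreStabilisedCircle` (crux `SmallCircleGap`, `A2DebyeScreening`, `k = 2`).

Why a separate object (lesson of the `AnchorGap` lead's wave 1, evidence `stub_debyeScreening.cex.md`
on stmt-QuantumFields-11141): at `ε > 0` the zero mode `φ̄` is NON-compact and the regulator `εΣ|φ|²`
distinguishes its `2π`-sectors by a linear source, so volume-uniform clustering of periodic observables
fails uniformly in `ε`; at `ε = 0` the partition function of `LatticeSineGordon` diverges (flat zero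
mode). The finite, physically right object integrates the zero-mode average over ONE period cell of a
lattice `Λ(b) = ⊕ ℤ b_j` leaving tilt and observables invariant (commensurate charges,
`α_r · b_j ∈ 2πℤ`); for such integrands the value does not depend on the cell.

## Contents

* `gradSq`, rigidity `eq_of_gradSq_eq_zero` (zero gradient ⇒ constant), the discrete POINCARÉ
  inequality `exists_poincare` (`Σ_x ψ_x² ≤ C_N gradSq ψ` for mean-zero `ψ`, by compactness),
  `gaussianAction_zero_eq`;
* `zeroModeAvg`, `zeroModeCell b`, `measurableSet_zeroModeCell`, `abs_zeroModeAvg_le`,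
  coercivity `exists_sum_sq_le_on_cell`;
* `compactPartitionFunction`, `compactExpect`, `compactTruncCorr` and the well-posedness API
  `integrableOn_weight_zeroModeCell`, `integrableOn_mul_weight_zeroModeCell`,
  `volume_zeroModeCell_pos`, `compactPartitionFunction_pos`, `abs_compactExpect_le`.

## Design choices and flags

* The cell is CLOSED (`parallelepiped` uses `Icc`); neighbouring translates overlap in a null set.
  Independence of the cell for `Λ(b)`-invariant integrands and the exact relation to the `ε`-model
  (sector decomposition) are NOT proved here (the `AnchorGap` helpers `expect_sector`, `obs_add_dual`
  under `Summits/QuantumFields/YangMills/Theorems` carry the sector identity).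
* No named facts; everything here is proved. Ratios of Bochner integrals as in `LatticeSineGordon.expect`
  (junk value when the cell is degenerate, i.e. `b` linearly dependent).

## References

* D. C. Brydges, Comm. Math. Phys. 58 (1978) 313–350, §1.2, §3.1–3.2 (periodised Gaussian, sectors
  `h`). [Brydges1978]
* M. Ünsal, L. G. Yaffe, Phys. Rev. D 78 (2008) 065035, §3 (compact dual photons of the neutral
  monopole plasma). [UnsalYaffe2008]
* S. Friedli, Y. Velenik, Statistical Mechanics of Lattice Systems (2017), §8.4 (massless GFF, zero
  mode on the torus). [FriedliVelenik2017]
-/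

noncomputable section

open MeasureTheory Finset Real
open scoped BigOperators

namespace Literature.Probability.LatticeModels

namespace LatticeSineGordon

variable {d N k : ℕ} [NeZero N] {ι : Type*} [Fintype ι]

/-- The gradient energy `Σ_x Σ_i (ψ(x+eᵢ) − ψ(x))²` of one real field on `(ℤ/N)ᵈ`. [folklore] -/
def gradSq (ψ : TorusSite d N → ℝ) : ℝ :=
  ∑ x : TorusSite d N, ∑ i : Fin d, (ψ (x + Pi.single i 1) - ψ x) ^ 2

/-- The gradient energy is non-negative. [folklore] -/
theorem gradSq_nonneg (ψ : TorusSite d N → ℝ) : 0 ≤ gradSq ψ :=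
  sum_nonneg fun _ _ => sum_nonneg fun _ _ => sq_nonneg _

/-- Homogeneity: `gradSq (c • ψ) = c² gradSq ψ`. [folklore] -/
theorem gradSq_smul (c : ℝ) (ψ : TorusSite d N → ℝ) : gradSq (c • ψ) = c ^ 2 * gradSq ψ := by
  simp only [gradSq, Pi.smul_apply, smul_eq_mul, mul_sum]
  refine sum_congr rfl fun x _ => sum_congr rfl fun i _ => by ring

/-- Adding a constant does not change the gradient energy. [folklore] -/
theorem gradSq_add_const (ψ : TorusSite d N → ℝ) (c : ℝ) :
    gradSq (fun x => ψ x + c) = gradSq ψ := by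
  simp only [gradSq]
  refine sum_congr rfl fun x _ => sum_congr rfl fun i _ => by ring

/-- **Rigidity**: a field with zero gradient energy on the torus is constant (move from `0` to `x`
coordinate by coordinate along unit jumps). [folklore] -/
theorem eq_of_gradSq_eq_zero {ψ : TorusSite d N → ℝ} (h : gradSq ψ = 0) (x : TorusSite d N) :
    ψ x = ψ 0 := by
  have hstep : ∀ (y : TorusSite d N) (i : Fin d), ψ (y + Pi.single i 1) = ψ y := by
    intro y i
    have hle : (ψ (y + Pi.single i 1) - ψ y) ^ 2 ≤ gradSq ψ := by
      unfold gradSq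
      calc (ψ (y + Pi.single i 1) - ψ y) ^ 2
          ≤ ∑ j : Fin d, (ψ (y + Pi.single j 1) - ψ y) ^ 2 :=
            Finset.single_le_sum (f := fun j : Fin d => (ψ (y + Pi.single j 1) - ψ y) ^ 2)
              (fun j _ => sq_nonneg (ψ (y + Pi.single j 1) - ψ y)) (mem_univ i)
        _ ≤ ∑ z : TorusSite d N, ∑ j : Fin d, (ψ (z + Pi.single j 1) - ψ z) ^ 2 :=
            Finset.single_le_sum
              (f := fun z : TorusSite d N => ∑ j : Fin d, (ψ (z + Pi.single j 1) - ψ z) ^ 2)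
              (fun z _ => sum_nonneg fun j _ => sq_nonneg (ψ (z + Pi.single j 1) - ψ z))
              (mem_univ y)
    rw [h] at hle
    have hterm : (ψ (y + Pi.single i 1) - ψ y) ^ 2 = 0 := le_antisymm hle (sq_nonneg _)
    exact sub_eq_zero.1 (pow_eq_zero_iff two_ne_zero |>.1 hterm)
  have hmul : ∀ (y : TorusSite d N) (i : Fin d) (n : ℕ), ψ (y + Pi.single i (n : ZMod N)) = ψ y := by
    intro y i n
    induction n with
    | zero => rw [Nat.cast_zero, Pi.single_zero, add_zero]
    | succ n ih =>
      rw [Nat.cast_succ, Pi.single_add, ← add_assoc, hstep, ih]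
  have key : ∀ s : Finset (Fin d), ψ (∑ i ∈ s, (Pi.single i (x i) : TorusSite d N)) = ψ 0 := by
    intro s
    induction s using Finset.induction_on with
    | empty => rw [sum_empty]
    | insert a s ha ih =>
      rw [sum_insert ha, add_comm]
      have h := hmul (∑ i ∈ s, (Pi.single i (x i) : TorusSite d N)) a (x a).val
      rw [ZMod.natCast_zmod_val] at h
      rw [h, ih]
  have hx : x = ∑ i, (Pi.single i (x i) : TorusSite d N) := (univ_sum_single x).symm
  rw [hx]
  exact key univ

/-- **Discrete Poincaré inequality on the torus**: there is `C ≥ 0` (depending on `d`, `N`) with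
`Σ_x ψ_x² ≤ C · gradSq ψ` for every mean-zero field `ψ`. Proof: on the compact set of mean-zero fields
with `Σ ψ² = 1` the continuous function `gradSq` is positive (rigidity), hence bounded below by some
`λ > 0`; homogeneity gives `gradSq ψ ≥ λ Σ ψ²`. [cite: FriedliVelenik2017, §8.4] -/
theorem exists_poincare (d N : ℕ) [NeZero N] : ∃ C : ℝ, 0 ≤ C ∧ ∀ ψ : TorusSite d N → ℝ,
    ∑ x, ψ x = 0 → ∑ x, ψ x ^ 2 ≤ C * gradSq ψ := by
  set S : Set (TorusSite d N → ℝ) := {ψ | ∑ x, ψ x = 0 ∧ ∑ x, ψ x ^ 2 = 1} with hS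
  have hcont : Continuous (gradSq : (TorusSite d N → ℝ) → ℝ) := by
    unfold gradSq; fun_prop
  have hSc : IsCompact S := by
    refine Metric.isCompact_of_isClosed_isBounded ?_ ?_
    · exact (isClosed_eq (by fun_prop) continuous_const).inter
        (isClosed_eq (by fun_prop) continuous_const)
    · refine (Metric.isBounded_Icc (-1 : TorusSite d N → ℝ) 1).subset ?_
      rintro ψ ⟨-, h2⟩
      have hψ : ∀ x, ψ x ^ 2 ≤ 1 := fun x =>
        h2 ▸ single_le_sum (f := fun y => ψ y ^ 2) (fun _ _ => sq_nonneg _) (mem_univ x)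
      exact ⟨fun x => by show -1 ≤ ψ x; nlinarith [hψ x], fun x => by show ψ x ≤ 1; nlinarith [hψ x]⟩
  -- normalisation of a non-zero mean-zero field lands in `S`
  have hnorm : ∀ ψ : TorusSite d N → ℝ, ∑ x, ψ x = 0 → ∑ x, ψ x ^ 2 ≠ 0 →
      ∃ r : ℝ, 0 < r ∧ r ^ 2 = ∑ x, ψ x ^ 2 ∧ r⁻¹ • ψ ∈ S := by
    intro ψ hψ h0
    have hq : 0 < ∑ x, ψ x ^ 2 := lt_of_le_of_ne (sum_nonneg fun _ _ => sq_nonneg _) (Ne.symm h0)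
    set r : ℝ := Real.sqrt (∑ x, ψ x ^ 2) with hr
    have hr2 : r ^ 2 = ∑ x, ψ x ^ 2 := Real.sq_sqrt hq.le
    have hrpos : 0 < r := Real.sqrt_pos.2 hq
    refine ⟨r, hrpos, hr2, ?_, ?_⟩
    · simp only [Pi.smul_apply, smul_eq_mul, ← mul_sum, hψ, mul_zero]
    · simp only [Pi.smul_apply, smul_eq_mul, mul_pow, ← mul_sum, ← hr2]
      field_simp
  by_cases hne : S.Nonempty
  · obtain ⟨ψ₀, hψ₀S, hmin⟩ := hSc.exists_isMinOn hne hcont.continuousOn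
    have hpos : 0 < gradSq ψ₀ := by
      rcases (gradSq_nonneg ψ₀).lt_or_eq with h | h
      · exact h
      · exfalso
        have hc := eq_of_gradSq_eq_zero h.symm
        obtain ⟨h1, h2⟩ := hψ₀S
        have hz : ψ₀ 0 = 0 := by
          rw [sum_congr rfl fun x _ => hc x, sum_const, card_univ, nsmul_eq_mul] at h1
          exact (mul_eq_zero.1 h1).resolve_left (Nat.cast_ne_zero.2 Fintype.card_ne_zero)
        have : ∑ x : TorusSite d N, ψ₀ x ^ 2 = 0 :=
          sum_eq_zero fun x _ => by rw [hc x, hz]; ring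
        rw [this] at h2
        exact zero_ne_one h2
    refine ⟨(gradSq ψ₀)⁻¹, inv_nonneg.2 hpos.le, fun ψ hψ => ?_⟩
    rcases eq_or_ne (∑ x, ψ x ^ 2) 0 with h0 | h0
    · rw [h0]; exact mul_nonneg (inv_nonneg.2 hpos.le) (gradSq_nonneg ψ)
    · obtain ⟨r, hrpos, hr2, hmem⟩ := hnorm ψ hψ h0
      have hge : gradSq ψ₀ ≤ gradSq (r⁻¹ • ψ) := hmin hmem
      rw [gradSq_smul] at hge
      calc ∑ x, ψ x ^ 2 = r ^ 2 := hr2.symm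
        _ = (gradSq ψ₀)⁻¹ * (r ^ 2 * gradSq ψ₀) := by field_simp
        _ ≤ (gradSq ψ₀)⁻¹ * (r ^ 2 * ((r⁻¹) ^ 2 * gradSq ψ)) := by gcongr
        _ = (gradSq ψ₀)⁻¹ * gradSq ψ := by field_simp
  · refine ⟨0, le_rfl, fun ψ hψ => ?_⟩
    rcases eq_or_ne (∑ x, ψ x ^ 2) 0 with h0 | h0
    · rw [h0, zero_mul]
    · obtain ⟨r, -, -, hmem⟩ := hnorm ψ hψ h0
      exact absurd ⟨_, hmem⟩ hne

/-- The zero-mode average `φ̄_a = |Λ|⁻¹ Σ_x φ(x)_a` of a configuration. [folklore] -/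
def zeroModeAvg (φ : Config d N k) : Fin k → ℝ :=
  fun a => (Fintype.card (TorusSite d N) : ℝ)⁻¹ * ∑ x : TorusSite d N, φ (x, a)

/-- The zero-mode average is continuous. [folklore] -/
theorem continuous_zeroModeAvg : Continuous (zeroModeAvg : Config d N k → Fin k → ℝ) := by
  unfold zeroModeAvg; fun_prop

/-- The constant configuration with value `v` has zero-mode average `v`. [folklore] -/
theorem zeroModeAvg_const (v : Fin k → ℝ) :
    zeroModeAvg (fun p : TorusSite d N × Fin k => v p.2) = v := by
  funext a
  simp only [zeroModeAvg, sum_const, card_univ, nsmul_eq_mul]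
  rw [← mul_assoc, inv_mul_cancel₀ (Nat.cast_ne_zero.2 Fintype.card_ne_zero), one_mul]

/-- **The period cell**: configurations whose zero-mode average lies in the closed parallelepiped
spanned by the family `b` (one fundamental domain of the lattice `⊕ ℤ b_j` acting on the zero mode by
global shifts, when `b` is linearly independent). [folklore] -/
def zeroModeCell (b : Fin k → Fin k → ℝ) : Set (Config d N k) :=
  zeroModeAvg ⁻¹' parallelepiped b

/-- The closed parallelepiped is closed. [folklore] -/
theorem isClosed_parallelepiped (b : Fin k → Fin k → ℝ) : IsClosed (parallelepiped b) :=
  (isCompact_Icc.image (show Continuous fun t : Fin k → ℝ => ∑ i, t i • b i by fun_prop)).isClosed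

/-- The period cell is measurable. [folklore] -/
theorem measurableSet_zeroModeCell (b : Fin k → Fin k → ℝ) :
    MeasurableSet (zeroModeCell (d := d) (N := N) b) :=
  ((isClosed_parallelepiped b).preimage continuous_zeroModeAvg).measurableSet

/-- On the period cell the zero-mode average is bounded: `|φ̄_a| ≤ Σ_j |b_j a|`. [folklore] -/
theorem abs_zeroModeAvg_le {b : Fin k → Fin k → ℝ} {φ : Config d N k} (hφ : φ ∈ zeroModeCell b)
    (a : Fin k) : |zeroModeAvg φ a| ≤ ∑ j, |b j a| := by
  obtain ⟨t, ht, hφt⟩ := (mem_parallelepiped_iff b (zeroModeAvg φ)).1 hφ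
  rw [hφt]
  simp only [Finset.sum_apply, Pi.smul_apply, smul_eq_mul]
  refine (abs_sum_le_sum_abs _ _).trans (sum_le_sum fun j _ => ?_)
  rw [abs_mul, abs_of_nonneg (ht.1 j)]
  exact mul_le_of_le_one_left (abs_nonneg _) (ht.2 j)

/-- At `ε = 0` the Gaussian action is `(2g²)⁻¹ Σ_a gradSq(φ_a)`. [folklore] -/
theorem gaussianAction_zero_eq (g : ℝ) (φ : Config d N k) :
    gaussianAction g 0 φ = (2 * g ^ 2)⁻¹ * ∑ a : Fin k, gradSq (fun x => φ (x, a)) := by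
  unfold gaussianAction gradSq
  rw [zero_mul, add_zero]
  congr 1
  calc ∑ x : TorusSite d N, ∑ i : Fin d, ∑ a : Fin k, (φ (x + Pi.single i 1, a) - φ (x, a)) ^ 2
      = ∑ x : TorusSite d N, ∑ a : Fin k, ∑ i : Fin d, (φ (x + Pi.single i 1, a) - φ (x, a)) ^ 2 :=
        Finset.sum_congr rfl fun x _ => Finset.sum_comm
    _ = ∑ a : Fin k, ∑ x : TorusSite d N, ∑ i : Fin d, (φ (x + Pi.single i 1, a) - φ (x, a)) ^ 2 :=
        Finset.sum_comm

/-- **Coercivity on the cell**: there are constants `A ≥ 0`, `B > 0` (depending on `d, N, k, b`) with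
`Σ_p φ_p² ≤ A + B Σ_a gradSq(φ_a)` for every `φ` in the period cell (Poincaré inequality for the
mean-zero part, boundedness of the zero mode on the cell). [folklore] -/
theorem exists_sum_sq_le_on_cell (d N k : ℕ) [NeZero N] (b : Fin k → Fin k → ℝ) :
    ∃ A B : ℝ, 0 ≤ A ∧ 0 < B ∧ ∀ φ : Config d N k, φ ∈ zeroModeCell b →
      ∑ p : TorusSite d N × Fin k, φ p ^ 2 ≤ A + B * ∑ a : Fin k, gradSq (fun x => φ (x, a)) := by
  obtain ⟨C, hC0, hC⟩ := exists_poincare d N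
  set n : ℝ := (Fintype.card (TorusSite d N) : ℝ) with hn
  have hnpos : 0 < n := Nat.cast_pos.2 Fintype.card_pos
  refine ⟨2 * n * ∑ a : Fin k, (∑ j : Fin k, |b j a|) ^ 2, 2 * C + 1, by positivity, by positivity,
    fun φ hφ => ?_⟩
  have hcomp : ∀ a : Fin k, ∑ x : TorusSite d N, φ (x, a) ^ 2 ≤
      2 * n * (∑ j : Fin k, |b j a|) ^ 2 + (2 * C + 1) * gradSq (fun x => φ (x, a)) := by
    intro a
    set m : ℝ := zeroModeAvg φ a with hm
    have hmean : ∑ x : TorusSite d N, (φ (x, a) + -m) = 0 := by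
      rw [sum_add_distrib, sum_const, card_univ, nsmul_eq_mul, hm]
      show (∑ x, φ (x, a)) + (Fintype.card (TorusSite d N) : ℝ) *
        -((Fintype.card (TorusSite d N) : ℝ)⁻¹ * ∑ x, φ (x, a)) = 0
      rw [← hn]
      field_simp
      ring
    have hP := hC (fun x => φ (x, a) + -m) hmean
    rw [gradSq_add_const (fun x => φ (x, a)) (-m)] at hP
    have hmb : m ^ 2 ≤ (∑ j : Fin k, |b j a|) ^ 2 := by
      rw [← sq_abs m]
      exact pow_le_pow_left₀ (abs_nonneg m) (abs_zeroModeAvg_le hφ a) 2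
    have hpt : ∀ x : TorusSite d N, φ (x, a) ^ 2 ≤ 2 * m ^ 2 + 2 * (φ (x, a) + -m) ^ 2 := by
      intro x; nlinarith [sq_nonneg (φ (x, a) - 2 * m)]
    have hg0 := gradSq_nonneg (fun x => φ (x, a))
    calc ∑ x : TorusSite d N, φ (x, a) ^ 2
        ≤ ∑ x : TorusSite d N, (2 * m ^ 2 + 2 * (φ (x, a) + -m) ^ 2) := sum_le_sum fun x _ => hpt x
      _ = 2 * n * m ^ 2 + 2 * ∑ x : TorusSite d N, (φ (x, a) + -m) ^ 2 := by
          rw [sum_add_distrib, sum_const, card_univ, nsmul_eq_mul, ← mul_sum, hn]; ring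
      _ ≤ 2 * n * (∑ j : Fin k, |b j a|) ^ 2 + 2 * (C * gradSq (fun x => φ (x, a))) := by
          gcongr
      _ ≤ 2 * n * (∑ j : Fin k, |b j a|) ^ 2 + (2 * C + 1) * gradSq (fun x => φ (x, a)) := by
          nlinarith
  calc ∑ p : TorusSite d N × Fin k, φ p ^ 2
      = ∑ a : Fin k, ∑ x : TorusSite d N, φ (x, a) ^ 2 := by
        rw [← Finset.univ_product_univ, Finset.sum_product_right]
    _ ≤ ∑ a : Fin k, (2 * n * (∑ j : Fin k, |b j a|) ^ 2 + (2 * C + 1) * gradSq (fun x => φ (x, a))) :=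
        sum_le_sum fun a _ => hcomp a
    _ = 2 * n * ∑ a : Fin k, (∑ j : Fin k, |b j a|) ^ 2 +
          (2 * C + 1) * ∑ a : Fin k, gradSq (fun x => φ (x, a)) := by
        rw [sum_add_distrib, ← mul_sum, ← mul_sum]

/-- **The `ε = 0` weight is integrable on the period cell** (`g ≠ 0`): on the cell it is dominated by
`K · Π_p e^{−c φ_p²}` with `c > 0`. [folklore] -/
theorem integrableOn_weight_zeroModeCell (α : ι → Fin k → ℝ) {g : ℝ} (hg : g ≠ 0) (ζ : ℝ)
    (b : Fin k → Fin k → ℝ) :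
    IntegrableOn (weight (d := d) (N := N) α g 0 ζ) (zeroModeCell b) := by
  obtain ⟨A, B, hA, hB, hAB⟩ := exists_sum_sq_le_on_cell d N k b
  have hg2 : 0 < 2 * g ^ 2 := by positivity
  set c : ℝ := (2 * g ^ 2)⁻¹ * B⁻¹ with hc
  have hcpos : 0 < c := by positivity
  set K : ℝ := Real.exp (2 * |ζ| * (Fintype.card (TorusSite d N) * Fintype.card ι) + c * A) with hK
  have hprod : Integrable (fun φ : Config d N k => K * ∏ p : TorusSite d N × Fin k, Real.exp (-c * φ p ^ 2)) :=
    (Integrable.fintype_prod (f := fun _ : TorusSite d N × Fin k => fun t : ℝ => Real.exp (-c * t ^ 2))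
      fun _ => integrable_exp_neg_mul_sq hcpos).const_mul K
  refine hprod.integrableOn.mono' (continuous_weight α g 0 ζ).aestronglyMeasurable ?_
  refine (ae_restrict_mem (measurableSet_zeroModeCell b)).mono fun φ hφ => ?_
  rw [Real.norm_eq_abs, abs_of_pos (weight_pos α g 0 ζ φ), ← Real.exp_sum, hK, ← Real.exp_add, weight]
  refine Real.exp_le_exp.2 ?_
  have ht := (abs_le.1 (abs_tilt_le (d := d) (N := N) α ζ φ)).2
  have hact : gaussianAction g 0 φ ≥ c * (∑ p : TorusSite d N × Fin k, φ p ^ 2) - c * A := by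
    rw [gaussianAction_zero_eq]
    have h1 := hAB φ hφ
    have h2 : c * (∑ p : TorusSite d N × Fin k, φ p ^ 2) ≤ c * A + c * B * ∑ a, gradSq (fun x => φ (x, a)) := by
      have := mul_le_mul_of_nonneg_left h1 hcpos.le
      linarith [this, show c * (A + B * ∑ a, gradSq fun x => φ (x, a)) = c * A + c * B * ∑ a, gradSq (fun x => φ (x, a)) by ring]
    have h3 : c * B = (2 * g ^ 2)⁻¹ := by rw [hc]; field_simp
    rw [h3] at h2
    linarith
  have hsum : ∑ p : TorusSite d N × Fin k, -c * φ p ^ 2 = -(c * ∑ p : TorusSite d N × Fin k, φ p ^ 2) := by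
    rw [mul_sum, ← sum_neg_distrib]
    exact sum_congr rfl fun p _ => by ring
  rw [hsum]
  linarith

/-- A bounded measurable observable times the `ε = 0` weight is integrable on the cell. [folklore] -/
theorem integrableOn_mul_weight_zeroModeCell (α : ι → Fin k → ℝ) {g : ℝ} (hg : g ≠ 0) (ζ : ℝ)
    (b : Fin k → Fin k → ℝ) {F : Config d N k → ℝ} (hF : AEStronglyMeasurable F volume) {M : ℝ}
    (hM : ∀ φ, |F φ| ≤ M) :
    IntegrableOn (fun φ : Config d N k => F φ * weight α g 0 ζ φ) (zeroModeCell b) := by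
  refine ((integrableOn_weight_zeroModeCell α hg ζ b).const_mul M).mono'
    (hF.restrict.mul (continuous_weight α g 0 ζ).aestronglyMeasurable) (Filter.Eventually.of_forall fun φ => ?_)
  have hw := weight_pos α g 0 ζ φ
  have hle : |F φ| * weight α g 0 ζ φ ≤ M * weight α g 0 ζ φ := mul_le_mul_of_nonneg_right (hM φ) hw.le
  simpa only [Real.norm_eq_abs, abs_mul, abs_of_pos hw] using hle

/-- **Partition function of the compact (neutral) gas**: the `ε = 0` weight integrated over the period
cell of `b`. [cite: Brydges1978, §1.2 and §3.1 (periodised Gaussian, sectors h)] -/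
def compactPartitionFunction (b : Fin k → Fin k → ℝ) (α : ι → Fin k → ℝ) (g ζ : ℝ) : ℝ :=
  ∫ φ in zeroModeCell (d := d) (N := N) b, weight α g 0 ζ φ

/-- **Expectation in the compact (neutral) gas** `⟨F⟩ = ∫_cell F e^{−S₀+tilt} / ∫_cell e^{−S₀+tilt}`
(meaningful for `Λ(b)`-periodic `F` and tilt: commensurate charges). [cite: UnsalYaffe2008, §3 (compact dual photon / neutral monopole plasma)] -/
def compactExpect (b : Fin k → Fin k → ℝ) (α : ι → Fin k → ℝ) (g ζ : ℝ) (F : Config d N k → ℝ) : ℝ :=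
  (∫ φ in zeroModeCell (d := d) (N := N) b, F φ * weight α g 0 ζ φ) /
    compactPartitionFunction (d := d) (N := N) b α g ζ

/-- Truncated two-point function of the compact gas. [folklore] -/
def compactTruncCorr (b : Fin k → Fin k → ℝ) (α : ι → Fin k → ℝ) (g ζ : ℝ) (F G : Config d N k → ℝ) :
    ℝ :=
  compactExpect b α g ζ (fun φ => F φ * G φ) - compactExpect b α g ζ F * compactExpect b α g ζ G

/-- For a linearly independent family `b` the period cell has positive Lebesgue measure (it contains
the open preimage of the interior of the parallelepiped, which meets the constants). [folklore] -/
theorem volume_zeroModeCell_pos {b : Fin k → Fin k → ℝ} (hb : LinearIndependent ℝ b) :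
    0 < volume (zeroModeCell (d := d) (N := N) b) := by
  have hcard : Fintype.card (Fin k) = Module.finrank ℝ (Fin k → ℝ) := by simp
  set B : Module.Basis (Fin k) ℝ (Fin k → ℝ) := basisOfLinearIndependentOfCardEqFinrank' b hb hcard
    with hBdef
  have hBb : (B : Fin k → Fin k → ℝ) = b := by
    rw [hBdef, coe_basisOfLinearIndependentOfCardEqFinrank']
  have hint : (interior (parallelepiped b)).Nonempty := by
    have := B.parallelepiped.interior_nonempty
    rwa [Module.Basis.coe_parallelepiped, hBb] at this
  obtain ⟨v, hv⟩ := hint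
  have hopen : IsOpen (zeroModeAvg ⁻¹' interior (parallelepiped b) : Set (Config d N k)) :=
    isOpen_interior.preimage continuous_zeroModeAvg
  have hne : (zeroModeAvg ⁻¹' interior (parallelepiped b) : Set (Config d N k)).Nonempty :=
    ⟨fun p => v p.2, Set.mem_preimage.2 (by rw [zeroModeAvg_const]; exact hv)⟩
  exact (hopen.measure_pos volume hne).trans_le (measure_mono (Set.preimage_mono interior_subset))

/-- **The compact partition function is positive** (`g ≠ 0`, `b` linearly independent). [folklore] -/
theorem compactPartitionFunction_pos {b : Fin k → Fin k → ℝ} (hb : LinearIndependent ℝ b)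
    (α : ι → Fin k → ℝ) {g : ℝ} (hg : g ≠ 0) (ζ : ℝ) :
    0 < compactPartitionFunction (d := d) (N := N) b α g ζ := by
  unfold compactPartitionFunction
  rw [integral_pos_iff_support_of_nonneg_ae (Filter.Eventually.of_forall fun φ => (weight_pos α g 0 ζ φ).le)
    (integrableOn_weight_zeroModeCell α hg ζ b)]
  have hsupp : Function.support (weight (d := d) (N := N) α g 0 ζ) = Set.univ :=
    Set.eq_univ_of_forall fun φ => (weight_pos α g 0 ζ φ).ne'
  rw [hsupp, Measure.restrict_apply MeasurableSet.univ, Set.univ_inter]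
  exact volume_zeroModeCell_pos hb

/-- `|⟨F⟩| ≤ M` in the compact gas when `|F| ≤ M` pointwise (bounded measurable `F`, `g ≠ 0`, `b` linearly
independent). [folklore] -/
theorem abs_compactExpect_le {b : Fin k → Fin k → ℝ} (hb : LinearIndependent ℝ b) (α : ι → Fin k → ℝ)
    {g : ℝ} (hg : g ≠ 0) (ζ : ℝ) {F : Config d N k → ℝ} (hF : AEStronglyMeasurable F volume) {M : ℝ}
    (hM : ∀ φ, |F φ| ≤ M) : |compactExpect b α g ζ F| ≤ M := by
  have hZ := compactPartitionFunction_pos (d := d) (N := N) hb α hg ζ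
  unfold compactExpect
  rw [abs_div, abs_of_pos hZ, div_le_iff₀ hZ]
  calc |∫ φ in zeroModeCell b, F φ * weight α g 0 ζ φ|
      ≤ ∫ φ in zeroModeCell b, |F φ * weight α g 0 ζ φ| := abs_integral_le_integral_abs
    _ ≤ ∫ φ in zeroModeCell b, M * weight α g 0 ζ φ := by
        refine integral_mono (integrableOn_mul_weight_zeroModeCell α hg ζ b hF hM).abs
          ((integrableOn_weight_zeroModeCell α hg ζ b).const_mul M) fun φ => ?_
        have hw := weight_pos α g 0 ζ φ
        have hle : |F φ| * weight α g 0 ζ φ ≤ M * weight α g 0 ζ φ := mul_le_mul_of_nonneg_right (hM φ) hw.le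
        simpa only [abs_mul, abs_of_pos hw] using hle
    _ = M * compactPartitionFunction (d := d) (N := N) b α g ζ := by
        rw [integral_const_mul]; rfl

end LatticeSineGordon

end Literature.Probability.LatticeModels
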